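import Literature.Geometry.Riemannian.LevelSetFlowWeakSetFlow
import Literature.Geometry.Riemannian.WeakSetFlowTimeShift
import HarnessLib

/-!
# The semigroup property of the level set flow

Topic `Literature/Geometry/Riemannian`. For closed `K₀ ⊆ ℝⁿ⁺¹` (`n ≥ 1`) and `s, t ≥ 0` the
tree's level set flow (`levelSetFlow`, White's biggest weak set flow) satisfies

  `F_{t+s}(K₀) = F_t(F_s(K₀))`   (`levelSetFlow_add`)

(White 2000, §2: "the level set flow has the semigroup property"). `⊆`: the time-translated level
set flow is a weak set flow from inside `F_s(K₀)` (`isWeakSetFlowIn_levelSetFlow` of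
`LevelSetFlowWeakSetFlow.lean`, `IsWeakSetFlowIn.comp_add` of `WeakSetFlowTimeShift.lean`),
hence below the biggest one; `⊇`: a competitor from inside `F_s(K₀)`, translated to start at
time `s` and concatenated with the level set flow of `K₀` on `[0, s]`
(`IsWeakSetFlowIn.concat`), is a weak set flow from inside `K₀`. Corollaries:
`levelSetFlow_add_subset`, `levelSetFlow_add_eq_empty`. Everything is PROVED; no definitions,
no named facts.

## References

* B. White, *The size of the singular set in mean curvature flow of mean-convex sets*, J. Amer.
  Math. Soc. 13 (2000), §2. [White2000]
-/

noncomputable section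

open Bundle Set Function Metric Module Filter
open scoped Manifold ContDiff Topology

namespace Literature.Geometry.Riemannian

open Lorentzian Lorentzian.PseudoRiemannianMetric

section Semigroup

variable {n : ℕ}

/-- **The semigroup property of the level set flow** (White 2000, §2): for closed `K₀ ⊆ ℝⁿ⁺¹`
(`n ≥ 1`) and `s, t ≥ 0`, `F_{t+s}(K₀) = F_t(F_s(K₀))`. `⊆`: the time-translated level set flow
`r ↦ F_{r+s}(K₀)` is a weak set flow on `[0, ∞)` from inside `F_s(K₀)`
(`isWeakSetFlowIn_levelSetFlow`, `IsWeakSetFlowIn.comp_add`), hence below the biggest one. `⊇`: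
a weak set flow `K` from inside `F_s(K₀)`, translated to start at time `s` and concatenated with
the level set flow of `K₀` on `[0, s]` (`IsWeakSetFlowIn.concat`), is a weak set flow from inside
`K₀`, hence `K t ⊆ F_{t+s}(K₀)`. [cite: White2000, §2] -/
theorem levelSetFlow_add (hn : 1 ≤ n) {K₀ : Set (EuclideanSpace ℝ (Fin (n + 1)))}
    (hK₀ : IsClosed K₀) {s t : ℝ} (hs : 0 ≤ s) (ht : 0 ≤ t) :
    levelSetFlow (euclideanMetric (EuclideanSpace ℝ (Fin (n + 1)))) K₀ (t + s) =
      levelSetFlow (euclideanMetric (EuclideanSpace ℝ (Fin (n + 1))))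
        (levelSetFlow (euclideanMetric (EuclideanSpace ℝ (Fin (n + 1)))) K₀ s) t := by
  set g := euclideanMetric (EuclideanSpace ℝ (Fin (n + 1))) with hg
  have hL := isWeakSetFlowIn_levelSetFlow hn hK₀
  refine Subset.antisymm ?_ ?_
  · -- `⊆`: the translated level set flow is a weak set flow from inside `F_s(K₀)`
    have hshift : IsWeakSetFlowIn g univ (Ici 0) fun r ↦ levelSetFlow g K₀ (r + s) :=
      (hL.comp_add s).mono_time fun r (hr : 0 ≤ r) ↦ show 0 ≤ r + s from add_nonneg hr hs
    have h0 : (fun r ↦ levelSetFlow g K₀ (r + s)) 0 ⊆ levelSetFlow g K₀ s := by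
      simp only [zero_add]; exact Subset.rfl
    exact subset_levelSetFlow hshift h0 ht
  · -- `⊇`: concatenate the level set flow on `[0, s]` with a translated competitor
    intro x hx
    obtain ⟨-, K, hK, hK0, hxK⟩ := hx
    have h₁ : IsWeakSetFlowIn g univ (Icc 0 s) (levelSetFlow g K₀) :=
      hL.mono_time fun r hr ↦ hr.1
    have h₂ : IsWeakSetFlowIn g univ (Ici s) fun r ↦ K (r + -s) :=
      (hK.comp_add (-s)).mono_time fun r (hr : s ≤ r) ↦ show (0 : ℝ) ≤ r + -s by linarith
    have h12 : (fun r ↦ K (r + -s)) s ⊆ levelSetFlow g K₀ s := by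
      simp only [add_neg_cancel]; exact hK0
    have hcat := h₁.concat hs h₂ h12
    have hcat0 : (fun r ↦ if r ≤ s then levelSetFlow g K₀ r else K (r + -s)) 0 ⊆ K₀ := by
      simp only [if_pos hs]
      exact levelSetFlow_zero_subset K₀
    have key := subset_levelSetFlow hcat hcat0 (t := t + s) (by linarith)
    refine key ?_
    rcases eq_or_lt_of_le ht with rfl | ht'
    · simp only [zero_add, if_pos le_rfl]
      exact hK0 hxK
    · have hts : ¬ (t + s ≤ s) := by linarith
      simp only [if_neg hts, add_neg_cancel_right]
      exact hxK

/-- The level set flow is **non-increasing along the semigroup**: `F_{t+s}(K₀) ⊆ F_t(F_s(K₀))` holds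
for every (not necessarily closed) `K₀ ⊆ ℝⁿ⁺¹` whose level set flow is a weak set flow — in
particular, by `levelSetFlow_add`, restarting the flow from a later slice reproduces it.
Restated for closed `K₀` as monotonicity in the initial set of the two-parameter family:
`F_t(F_s(K₀)) ⊆ F_t(K₀')` whenever `F_s(K₀) ⊆ K₀'`. [cite: White2000, §2] -/
theorem levelSetFlow_add_subset (hn : 1 ≤ n) {K₀ K₀' : Set (EuclideanSpace ℝ (Fin (n + 1)))}
    (hK₀ : IsClosed K₀) {s t : ℝ} (hs : 0 ≤ s) (ht : 0 ≤ t)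
    (h : levelSetFlow (euclideanMetric (EuclideanSpace ℝ (Fin (n + 1)))) K₀ s ⊆ K₀') :
    levelSetFlow (euclideanMetric (EuclideanSpace ℝ (Fin (n + 1)))) K₀ (t + s) ⊆
      levelSetFlow (euclideanMetric (EuclideanSpace ℝ (Fin (n + 1)))) K₀' t := by
  rw [levelSetFlow_add hn hK₀ hs ht]
  exact levelSetFlow_mono h t

/-- **Once extinct, always extinct; once inside a set, inside its flow**: if `F_s(K₀) = ∅` then
`F_{t+s}(K₀) = ∅` (`t, s ≥ 0`, closed `K₀`) — the semigroup form of
`levelSetFlow_eq_empty_of_eq_empty`. [cite: White2000, §2] -/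
theorem levelSetFlow_add_eq_empty (hn : 1 ≤ n) {K₀ : Set (EuclideanSpace ℝ (Fin (n + 1)))}
    (hK₀ : IsClosed K₀) {s t : ℝ} (hs : 0 ≤ s) (ht : 0 ≤ t)
    (h : levelSetFlow (euclideanMetric (EuclideanSpace ℝ (Fin (n + 1)))) K₀ s = ∅) :
    levelSetFlow (euclideanMetric (EuclideanSpace ℝ (Fin (n + 1)))) K₀ (t + s) = ∅ := by
  rw [levelSetFlow_add hn hK₀ hs ht, h]
  refine Set.eq_empty_of_forall_notMem fun x hx ↦ ?_
  obtain ⟨-, K, hK, hK0, hxK⟩ := hx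
  have hK0' : K 0 = ∅ := subset_empty_iff.1 hK0
  have := hK.eq_empty_of_eq_empty hn ht (fun r hr ↦ hr.1) hK0'
  rw [this] at hxK
  exact hxK

end Semigroup

end Literature.Geometry.Riemannian

end
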